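import Literature.Analysis.FluidPDE.TorusNSBeltramiGlobalStability
import Literature.Analysis.FluidPDE.BeltramiWavesCurl
import HarnessLib

/-!
# Beltrami–Trkal data on `T³` in the pointwise-curl vocabulary: `curl w = λw ⟹ (w·∇)w = ∇(|w|²/2)`,
# `Δw = −λ²w`, exact decay, Pizzocchero's stability radius; the Beltrami waves of the
# intermittent constructions as exact decaying solutions

Analysis/FluidPDE support file (theorems only; no definitions, no named facts); the bridge between
`TorusNSBeltramiGlobalStability` (orientation-free frame vocabulary `W_{i⁺i⁺⁺} = λwᵢ`,
`W = torusVorticityTensor w`) and the tree's pointwise curl on `T³ = UnitAddTorus (Fin 3)`,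
`BDSV.curl` of `OnsagerBDSVGluing` (`(curl v)₀ = ∂₁v₂ − ∂₂v₁`, …), used by `BeltramiWavesCurl`,
`TorusNSAnisotropicVorticityCriterion`, `TorusVorticityTensorTransport`, …. Search for candidate a
priori estimates; no regularity claim.

Sources. L. Pizzocchero, *Appl. Math. Lett.* 115 (2021) 106970, §6 with footnote 8 (for `d = 3`
a Beltrami–Trkal datum `rot v₀ = ±κv₀` satisfies `Δv₀ = −rot rot v₀ = −κ²v₀` and
`(v₀·∇)v₀ = (rot v₀) ∧ v₀ + ∇(|v₀|²/2) = ∇(|v₀|²/2)`; (6.3) `v(t) = e^{−κ²νt}v₀`; Thm. 5.1 with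
(6.5) `ρ_n = (ν/G_n)e^{−(G_n + K_nκ)κ^{n−2}‖v₀‖_{L²}/ν}`); A. J. Majda, A. L. Bertozzi,
*Vorticity and Incompressible Flow* (CUP 2002), §1.4 (1.19)–(1.21) (the rotation matrix and
`ω = curl v`), §2.3.2 Def. 2.1 (2.38) (`curl v = λv`), Prop. 2.10, p. 61
(`v^ν(x,t) = e^{−λ̄²νt}v⁰(x)`); T. Luo, E. S. Titi, Calc. Var. PDE 59 (2020), §3.2 Prop. 1
(= Buckmaster–Vicol 2019, Prop. 3.1: the Beltrami waves `W = ∑_ξ a_ξ B_ξ e_{λξ}`, `curl W = λW`,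
here `curl W = 2π·5n·W` on the unit torus, `curl_beltramiField`).

* §1 `Torus.bdsvCurl_apply_eq_torusVorticityTensor` — `(BDSV.curl v x)ᵢ = W_{i+1,i+2}(x)`
  (`(W₁₂, W₂₀, W₀₁) = curl v`); `Torus.torusVorticityTensor_eq_of_curl_eq_smul` — a pointwise
  `curl w = λ • w` is the frame hypothesis of `TorusNSBeltramiGlobalStability` for `Equiv.refl (Fin 3)`.
* §2 the curl-form statements: `Torus.convect_self_eq_gradient_of_curl_eq_smul`,
  `Torus.laplacian_eq_neg_sq_smul_of_curl_eq_smul`, `Torus.isClassicalNSSolutionOn_expDecay_of_curl_eq_smul`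
  (`e^{−νλ²t}w` with Bernoulli pressure is a classical solution on `[0, ∞)`, every `ν`),
  `Torus.classicalNS_global_stability_of_curl_eq_smul_three` (Thm. 5.1 with (6.5) at `n = 3`,
  hypothesis-free `G = 2π(24ζ₄)^{1/2}`, `K = 2π(B₃ζ₆)^{1/2}`; `κ = |λ|/(2π)`, `N = ‖w‖_{L²}`,
  `L = (Gκ³N + Kκ⁴N)/(νλ²)`, radius `Gδe^{L} < 4π²ν`).
* §3 the Beltrami waves of `BeltramiWaves`/`BeltramiWavesCurl` (`λ = 5n`):
  `IntermittentBeltrami.zero_not_mem_freqSet`, `IntermittentBeltrami.hasZeroMean_beltramiField`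
  (`n ≠ 0`, reality condition), `IntermittentBeltrami.isClassicalNSSolutionOn_beltramiField`
  (**`e^{−ν(2π·5n)²t}W` is an exact classical solution on `[0, ∞)` for every `ν`** — single-shell
  flows have no nonlinear transfer), `IntermittentBeltrami.classicalNS_global_stability_beltramiField_three`
  (Thm. 5.1 at the datum `W`: `κ = 5|n|`, `N = (∑_ξ |a_ξ|²)^{1/2}` by `integral_norm_sq_beltramiField`).

Beyond-source declarations (proved here; not statements printed in the cited texts — index line,
cell convention L-φ-1): the bridge lemma and the frame restatement (§1), the `_three`
instantiations (Thm. 5.1 with the tree constants — the glue exception), and §3 as a whole (the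
cited texts state `curl W = λW` and, separately, that strong Beltrami fields decay as `e^{−λ̄²νt}`;
their conjunction for these particular waves and the stability radius around them are
instantiations). Relation to the tree: `Summits/AnomalousDissipation/…/SoloBlindSweptBeltrami`
proves the `BDSV.curl` Lamb identity for its own use (summit side); the ABC flow instance is
`TorusABCFlow` (proposed separately). Stated for the special case we need (unit `T³`, `n = 3`,
zero forcing);
-- TODO(general form): `λ` may be a function for the Lamb step (MB Def. 2.1 allows `λ(x)`; only
-- `Δw = −λ²w` and the decay need constant `λ`); not needed here.

## References
* L. Pizzocchero, Appl. Math. Lett. 115 (2021) 106970, Thm. 5.1, §6 (6.1)–(6.5), footnote 8.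
  [Pizzocchero2021]
* A. J. Majda, A. L. Bertozzi, *Vorticity and Incompressible Flow*, CUP 2002, §1.4 (1.19)–(1.21),
  §2.3.2 Def. 2.1 (2.38), Prop. 2.10, p. 61, §2.4 (2.97). [MajdaBertozziCUP2002]
* T. Luo, E. S. Titi, Calc. Var. PDE 59 (2020) = arXiv:1808.07595, §3.2 Prop. 1. [LuoTiti2020]
* C. Morosi, L. Pizzocchero, Commun. Pure Appl. Anal. 11 (2012) 557–586, Lemma 5.3; C. Morosi,
  M. Pernici, L. Pizzocchero, Appl. Math. Comput. 308 (2017) 54–72, Lemma 5.3.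
  [MorosiPizzocchero2012Kato, MorosiPerniciPizzocchero2017]
-/

noncomputable section

open MeasureTheory Set Filter UnitAddTorus Function Finset
open scoped Topology BigOperators InnerProductSpace ComplexConjugate

namespace Literature.Analysis.FluidPDE

section CurlForm

open Literature.Analysis.FunctionSpaces Literature.Analysis.FunctionSpaces.Torus NSSobolev NSGevrey

/-! ### §1 The bridge `(curl v)ᵢ = W_{i+1,i+2}` -/

/-- Addition table of `Fin 3`. [folklore] -/
private theorem zd_fin3_add :
    (0 : Fin 3) + 1 = 1 ∧ (0 : Fin 3) + 2 = 2 ∧ (1 : Fin 3) + 1 = 2 ∧ (1 : Fin 3) + 2 = 0 ∧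
      (2 : Fin 3) + 1 = 0 ∧ (2 : Fin 3) + 2 = 1 := by
  decide

/-- Every index of `Fin 3` is `0`, `1` or `2`. [folklore] -/
private theorem zd_fin3_cases (i : Fin 3) : i = 0 ∨ i = 1 ∨ i = 2 := by
  fin_cases i <;> simp

/-- **The curl on `T³` is the cyclic part of the vorticity tensor**: `(curl v)ᵢ = W_{i+1, i+2}`,
`W = torusVorticityTensor v`, `Wⱼₗ = (∂ⱼv)ₗ − (∂ₗv)ⱼ` — i.e. `(W₁₂, W₂₀, W₀₁) = curl v`
(Majda–Bertozzi 2002, §1.4 (1.19)–(1.21): "in `d = 3` the entries of the rotation matrix are the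
components of `ω = curl v`"), for the tree's `BDSV.curl` of `OnsagerBDSVGluing`.
[cite: MajdaBertozziCUP2002, §1.4 eq. (1.20)–(1.21)] -/
theorem Torus.bdsvCurl_apply_eq_torusVorticityTensor
    (v : UnitAddTorus (Fin 3) → EuclideanSpace ℝ (Fin 3)) (x : UnitAddTorus (Fin 3)) (i : Fin 3) :
    BDSV.curl v x i = torusVorticityTensor v (i + 1) (i + 2) x := by
  obtain ⟨h0, h1, h2⟩ := IntermittentBeltrami.curl_apply_fin v x
  obtain ⟨h01, h02, h11, h12, h21, h22⟩ := zd_fin3_add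
  rcases zd_fin3_cases i with rfl | rfl | rfl
  · rw [h0, zero_add, zero_add, torusVorticityTensor]
  · rw [h1, h11, h12, torusVorticityTensor]
  · rw [h2, h21, h22, torusVorticityTensor]

/-- A pointwise Beltrami condition `curl w = λw` (the tree's `BDSV.curl`) is the frame hypothesis of
`TorusNSBeltramiGlobalStability` for the identity frame `Equiv.refl (Fin 3)`:
`W_{i+1,i+2}(x) = λ wᵢ(x)`. [cite: MajdaBertozziCUP2002, §2.3.2 Def. 2.1 eq. (2.38)] -/
theorem Torus.torusVorticityTensor_eq_of_curl_eq_smul {lam : ℝ}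
    {w : UnitAddTorus (Fin 3) → EuclideanSpace ℝ (Fin 3)} (hcurl : ∀ x, BDSV.curl w x = lam • w x)
    (i : Fin 3) (x : UnitAddTorus (Fin 3)) :
    torusVorticityTensor w ((Equiv.refl (Fin 3)).symm ((Equiv.refl (Fin 3)) i + 1))
        ((Equiv.refl (Fin 3)).symm ((Equiv.refl (Fin 3)) i + 2)) x = lam * w x i := by
  show torusVorticityTensor w (i + 1) (i + 2) x = lam * w x i
  rw [← Torus.bdsvCurl_apply_eq_torusVorticityTensor, hcurl x, PiLp.smul_apply, smul_eq_mul]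

/-! ### §2 The curl-form statements -/

/-- **`curl w = λw ⟹ (w·∇)w = ∇(|w|²/2)`** on `T³` for smooth `w` (Lamb form; Pizzocchero 2021
footnote 8, MB Prop. 2.10), curl in the tree's pointwise `BDSV.curl` vocabulary.
[cite: Pizzocchero2021, §6 footnote 8; MajdaBertozziCUP2002, §2.3.2 Prop. 2.10] -/
theorem Torus.convect_self_eq_gradient_of_curl_eq_smul {lam : ℝ}
    {w : UnitAddTorus (Fin 3) → EuclideanSpace ℝ (Fin 3)} (hw : Torus.IsSmooth w)
    (hcurl : ∀ x, BDSV.curl w x = lam • w x) (x : UnitAddTorus (Fin 3)) :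
    Torus.convect w w x = Torus.gradient (fun y => ‖w y‖ ^ 2 / 2) x :=
  Torus.convect_self_eq_gradient_of_beltrami (Equiv.refl (Fin 3)) hw
    (Torus.torusVorticityTensor_eq_of_curl_eq_smul hcurl) x

/-- **`curl w = λw`, `div w = 0 ⟹ Δw = −λ²w`** on `T³` for smooth `w`
(`Δ = −curl curl + ∇div`; Pizzocchero 2021 footnote 8). [cite: Pizzocchero2021, §6 footnote 8; MajdaBertozziCUP2002, §2.4 eq. (2.97)] -/
theorem Torus.laplacian_eq_neg_sq_smul_of_curl_eq_smul {lam : ℝ}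
    {w : UnitAddTorus (Fin 3) → EuclideanSpace ℝ (Fin 3)} (hw : Torus.IsSmooth w)
    (hdiv : Torus.IsDivFree w) (hcurl : ∀ x, BDSV.curl w x = lam • w x) (x : UnitAddTorus (Fin 3)) :
    Torus.laplacian w x = -(lam ^ 2 • w x) :=
  Torus.laplacian_eq_neg_sq_smul_of_beltrami (Equiv.refl (Fin 3)) hw hdiv
    (Torus.torusVorticityTensor_eq_of_curl_eq_smul hcurl) x

/-- **Strong Beltrami fields decay exactly under Navier–Stokes on `T³`**: for smooth divergence-free
`w` with `curl w = λw`, `v(t) = e^{−νλ²t}w` with the Bernoulli pressure `−e^{−2νλ²t}|w|²/2` is a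
classical solution of the unforced equations on `[0, ∞)` for every `ν` (MB p. 61
"`v^ν(x,t) = e^{−λ̄²νt}v⁰(x)`"; Pizzocchero 2021 (6.3)).
[cite: MajdaBertozziCUP2002, §2.3.2 p. 61; Pizzocchero2021, §6 (6.3) and footnote 8] -/
theorem Torus.isClassicalNSSolutionOn_expDecay_of_curl_eq_smul (ν : ℝ) {lam : ℝ}
    {w : UnitAddTorus (Fin 3) → EuclideanSpace ℝ (Fin 3)} (hw : Torus.IsSmooth w)
    (hdiv : Torus.IsDivFree w) (hcurl : ∀ x, BDSV.curl w x = lam • w x) :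
    Torus.IsClassicalNSSolutionOn (Ici 0) ν 0 (fun t x => Real.exp (-(ν * lam ^ 2) * t) • w x)
      (fun t x => (-(Real.exp (-(ν * lam ^ 2) * t) ^ 2)) * (‖w x‖ ^ 2 / 2)) :=
  Torus.isClassicalNSSolutionOn_expDecay_of_beltrami (Equiv.refl (Fin 3)) ν hw hdiv
    (Torus.torusVorticityTensor_eq_of_curl_eq_smul hcurl)

/-- **Global stability of strong Beltrami fields on `T³` (curl form), hypothesis-free constants**
(Pizzocchero 2021, Thm. 5.1 with §6 (6.5); `Torus.classicalNS_global_stability_of_beltrami_three`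
for the pointwise hypothesis `curl w = λw`, `λ ≠ 0`): with `κ = |λ|/(2π)`, `N = (∫‖w‖²)^{1/2}`,
`G = 2π(24ζ₄)^{1/2}`, `K = 2π(B₃ζ₆)^{1/2}`, `L = (Gκ³N + Kκ⁴N)/(νλ²)`, `δ = ‖u₀ − w‖₃`:
`Gδe^{L} < 4π²ν ⟹` the classical solution from `u₀` is global with
`‖u(t) − e^{−νλ²t}w‖₃ ≤ δe^{L}e^{−4π²νt}/(1 − Gδe^{L}/(4π²ν))`.
[cite: Pizzocchero2021, Thm. 5.1, §6 (6.2)–(6.5) and footnote 8; MorosiPizzocchero2012Kato, Lemma 5.3; MorosiPerniciPizzocchero2017, Lemma 5.3] -/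
theorem Torus.classicalNS_global_stability_of_curl_eq_smul_three {ν : ℝ} (hν : 0 < ν) {s : ℝ}
    (hs3 : s = 3) {lam : ℝ} (hlam : lam ≠ 0)
    {w : UnitAddTorus (Fin 3) → EuclideanSpace ℝ (Fin 3)} (hw : Torus.IsSmooth w)
    (hdivw : Torus.IsDivFree w) (hmw : Torus.HasZeroMean w)
    (hcurl : ∀ x, BDSV.curl w x = lam • w x)
    {u₀ : UnitAddTorus (Fin 3) → EuclideanSpace ℝ (Fin 3)} (hu₀ : Torus.IsSmooth u₀)
    (hdiv : Torus.IsDivFree u₀) (hmean : Torus.HasZeroMean u₀)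
    (hclose : 2 * Real.pi * Real.sqrt (24 *
        ∑' k : Fin 3 → ℤ, (if k = 0 then (0 : ℝ) else freqNormSq k ^ (-(s - 1)))) *
      Real.sqrt (∑' k : Fin 3 → ℤ, freqNormSq k ^ s *
        ‖mFourierCoeff (EuclideanSpace.complexify ∘ (fun y => u₀ y - w y)) k‖ ^ 2) *
        Real.exp ((2 * Real.pi * Real.sqrt (24 *
            ∑' k : Fin 3 → ℤ, (if k = 0 then (0 : ℝ) else freqNormSq k ^ (-(s - 1)))) *
            ((|lam| / (2 * Real.pi)) ^ s * Real.sqrt (∫ x, ‖w x‖ ^ 2)) +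
          2 * Real.pi * Real.sqrt (((2 : ℝ) ^ (2 * s + 2) * (s + 1) ^ (s + 1) / (s + 2) ^ (s + 2)) *
            ∑' k : Fin 3 → ℤ, (if k = 0 then (0 : ℝ) else freqNormSq k ^ (-s))) *
            ((|lam| / (2 * Real.pi)) ^ (s + 1) * Real.sqrt (∫ x, ‖w x‖ ^ 2))) / (ν * lam ^ 2)) <
        4 * Real.pi ^ 2 * ν) :
    ∃ (u : ℝ → UnitAddTorus (Fin 3) → EuclideanSpace ℝ (Fin 3))
      (p : ℝ → UnitAddTorus (Fin 3) → ℝ),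
      Torus.IsClassicalNSSolutionOn (Ici 0) ν 0 u p ∧ u 0 = u₀ ∧
      (∀ t ∈ Ici (0 : ℝ), Torus.HasZeroMean (u t)) ∧
      ∀ t ∈ Ici (0 : ℝ), Real.sqrt (∑' k : Fin 3 → ℤ, freqNormSq k ^ s *
        ‖mFourierCoeff (EuclideanSpace.complexify ∘
          (fun y => u t y - Real.exp (-(ν * lam ^ 2) * t) • w y)) k‖ ^ 2) ≤
        Real.sqrt (∑' k : Fin 3 → ℤ, freqNormSq k ^ s *
          ‖mFourierCoeff (EuclideanSpace.complexify ∘ (fun y => u₀ y - w y)) k‖ ^ 2) *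
          Real.exp ((2 * Real.pi * Real.sqrt (24 *
              ∑' k : Fin 3 → ℤ, (if k = 0 then (0 : ℝ) else freqNormSq k ^ (-(s - 1)))) *
              ((|lam| / (2 * Real.pi)) ^ s * Real.sqrt (∫ x, ‖w x‖ ^ 2)) +
            2 * Real.pi * Real.sqrt (((2 : ℝ) ^ (2 * s + 2) * (s + 1) ^ (s + 1) / (s + 2) ^ (s + 2)) *
              ∑' k : Fin 3 → ℤ, (if k = 0 then (0 : ℝ) else freqNormSq k ^ (-s))) *
              ((|lam| / (2 * Real.pi)) ^ (s + 1) * Real.sqrt (∫ x, ‖w x‖ ^ 2))) / (ν * lam ^ 2)) *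
          Real.exp (-(4 * Real.pi ^ 2 * ν) * t) /
          (1 - 2 * Real.pi * Real.sqrt (24 *
              ∑' k : Fin 3 → ℤ, (if k = 0 then (0 : ℝ) else freqNormSq k ^ (-(s - 1)))) *
            Real.sqrt (∑' k : Fin 3 → ℤ, freqNormSq k ^ s *
              ‖mFourierCoeff (EuclideanSpace.complexify ∘ (fun y => u₀ y - w y)) k‖ ^ 2) *
            Real.exp ((2 * Real.pi * Real.sqrt (24 *
                ∑' k : Fin 3 → ℤ, (if k = 0 then (0 : ℝ) else freqNormSq k ^ (-(s - 1)))) *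
                ((|lam| / (2 * Real.pi)) ^ s * Real.sqrt (∫ x, ‖w x‖ ^ 2)) +
              2 * Real.pi * Real.sqrt (((2 : ℝ) ^ (2 * s + 2) * (s + 1) ^ (s + 1) / (s + 2) ^ (s + 2)) *
                ∑' k : Fin 3 → ℤ, (if k = 0 then (0 : ℝ) else freqNormSq k ^ (-s))) *
                ((|lam| / (2 * Real.pi)) ^ (s + 1) * Real.sqrt (∫ x, ‖w x‖ ^ 2))) / (ν * lam ^ 2)) /
            (4 * Real.pi ^ 2 * ν)) :=
  Torus.classicalNS_global_stability_of_beltrami_three (d := Fin 3) (by simp) (Equiv.refl (Fin 3))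
    hν hs3 hlam hw hdivw hmw (Torus.torusVorticityTensor_eq_of_curl_eq_smul hcurl) hu₀ hdiv hmean
    hclose

/-! ### §3 The intermittent-construction Beltrami waves `W = ∑_ξ a_ξ B_ξ e_{λξ}` are exact
decaying solutions -/

/-- `λΛ` does not contain `0` for `n ≠ 0` (`|k| = 5|n|` on the shell). [cite: LuoTiti2020, §3.2 Prop. 1] -/
theorem IntermittentBeltrami.zero_not_mem_freqSet {n : ℤ} (hn : n ≠ 0) :
    (0 : Fin 3 → ℤ) ∉ IntermittentBeltrami.freqSet n := by
  intro h
  rw [IntermittentBeltrami.freqSet, Finset.mem_image] at h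
  obtain ⟨y, -, hy⟩ := h
  have h1 : ∑ q, ((IntermittentBeltrami.kvec n y q : ℤ) : ℝ) *
      ((IntermittentBeltrami.kvec n y q : ℤ) : ℝ) = 25 * (n : ℝ) ^ 2 := by
    simp_rw [IntermittentBeltrami.kvec_cast]
    rw [show (25 : ℝ) * (n : ℝ) ^ 2 = (5 * (n : ℝ)) ^ 2 * ∑ q, dir y q * dir y q by
      rw [sum_dir_sq]; ring, Finset.mul_sum]
    exact Finset.sum_congr rfl fun q _ => by ring
  rw [hy] at h1
  simp only [Pi.zero_apply, Int.cast_zero, mul_zero, Finset.sum_const_zero] at h1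
  have h2 : (n : ℝ) ^ 2 = 0 := by linarith
  exact hn (by exact_mod_cast pow_eq_zero_iff (n := 2) two_ne_zero |>.mp h2)

/-- A continuous field without mean mode has zero mean: `û(0) = complexify (∫ u)` (copy of the
tree's `hasZeroMean_of_mFourierCoeff_zero`, not in this import cone). [folklore] -/
private theorem zd_hasZeroMean_of_mFourierCoeff_zero
    {u : UnitAddTorus (Fin 3) → EuclideanSpace ℝ (Fin 3)}
    (h0 : mFourierCoeff (EuclideanSpace.complexify ∘ u) 0 = 0) : Torus.HasZeroMean u := by
  have h : mFourierCoeff (EuclideanSpace.complexify ∘ u) 0 =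
      EuclideanSpace.complexify (∫ x, u x) := by
    rw [mFourierCoeff_eq_integral_volume, neg_zero, mFourier_zero]
    simp only [ContinuousMap.one_apply, one_smul, Function.comp_apply]
    exact EuclideanSpace.complexify.integral_comp_comm u
  rw [h] at h0
  exact EuclideanSpace.complexify_injective (by rw [h0, map_zero])

/-- The Beltrami wave `W` has zero mean for `n ≠ 0` (no mode at `k = 0`).
[cite: LuoTiti2020, §3.2 Prop. 1] -/
theorem IntermittentBeltrami.hasZeroMean_beltramiField {a : LIndex → ℂ}
    (ha : IntermittentBeltrami.IsCoefSymm a) {n : ℤ} (hn : n ≠ 0) :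
    Torus.HasZeroMean (IntermittentBeltrami.beltramiField n a) :=
  zd_hasZeroMean_of_mFourierCoeff_zero
    (IntermittentBeltrami.mFourierCoeff_beltramiField_eq_zero ha n
      (IntermittentBeltrami.zero_not_mem_freqSet hn))

/-- **The Beltrami waves `W = ∑_{ξ∈Λ} a_ξ B_ξ e_{λξ}` (`λ = 5n`) of the intermittent constructions
are exact decaying Navier–Stokes solutions on `T³`**: `curl W = 2πλ W` (`curl_beltramiField`), so
`v(t) = e^{−ν(2πλ)²t}W` with pressure `−e^{−2ν(2πλ)²t}|W|²/2` is a classical solution on `[0, ∞)`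
for every `ν` (MB p. 61; single-shell flows have no nonlinear transfer).
[cite: LuoTiti2020, §3.2 Prop. 1; MajdaBertozziCUP2002, §2.3.2 p. 61] -/
theorem IntermittentBeltrami.isClassicalNSSolutionOn_beltramiField (ν : ℝ) (n : ℤ) (a : LIndex → ℂ) :
    Torus.IsClassicalNSSolutionOn (Ici 0) ν 0
      (fun t x => Real.exp (-(ν * (2 * Real.pi * (5 * n)) ^ 2) * t) •
        IntermittentBeltrami.beltramiField n a x)
      (fun t x => (-(Real.exp (-(ν * (2 * Real.pi * (5 * n)) ^ 2) * t) ^ 2)) *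
        (‖IntermittentBeltrami.beltramiField n a x‖ ^ 2 / 2)) :=
  Torus.isClassicalNSSolutionOn_expDecay_of_curl_eq_smul ν
    (IntermittentBeltrami.isSmooth_beltramiField n a) (IntermittentBeltrami.isDivFree_beltramiField n a)
    (IntermittentBeltrami.curl_beltramiField n a)

/-- `|2π·5n|/(2π) = 5|n|`: the lattice shell of the Beltrami waves. [folklore] -/
private theorem zd_abs_lam_div (n : ℤ) :
    |2 * Real.pi * (5 * (n : ℝ))| / (2 * Real.pi) = 5 * |(n : ℝ)| := by
  rw [abs_mul, abs_of_pos Real.two_pi_pos, abs_mul, abs_of_pos (by norm_num : (0 : ℝ) < 5)]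
  field_simp

/-- **Global stability of the Beltrami waves `W = ∑_ξ a_ξ B_ξ e_{λξ}` on `T³` in `Ḣ³`,
hypothesis-free constants** (Pizzocchero 2021, Thm. 5.1 with §6 (6.5) at the Beltrami–Trkal datum
`W`, `curl W = 2πλW`, `λ = 5n`, `n ≠ 0`, reality condition on `a`): lattice shell `κ = 5|n|`,
`N = ‖W‖_{L²} = (∑_ξ |a_ξ|²)^{1/2}` (`integral_norm_sq_beltramiField`), `G = 2π(24ζ₄)^{1/2}`,
`K = 2π(B₃ζ₆)^{1/2}`, `L = (Gκ³N + Kκ⁴N)/(ν(2πλ)²)`, `δ = ‖u₀ − W‖₃`: `Gδe^{L} < 4π²ν ⟹` the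
classical solution from `u₀` is global with
`‖u(t) − e^{−ν(2πλ)²t}W‖₃ ≤ δe^{L}e^{−4π²νt}/(1 − Gδe^{L}/(4π²ν))`.
[cite: Pizzocchero2021, Thm. 5.1, §6 (6.2)–(6.5); LuoTiti2020, §3.2 Prop. 1; MorosiPizzocchero2012Kato, Lemma 5.3; MorosiPerniciPizzocchero2017, Lemma 5.3] -/
theorem IntermittentBeltrami.classicalNS_global_stability_beltramiField_three {ν : ℝ} (hν : 0 < ν)
    {s : ℝ} (hs3 : s = 3) {n : ℤ} (hn : n ≠ 0) {a : LIndex → ℂ}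
    (ha : IntermittentBeltrami.IsCoefSymm a)
    {u₀ : UnitAddTorus (Fin 3) → EuclideanSpace ℝ (Fin 3)} (hu₀ : Torus.IsSmooth u₀)
    (hdiv : Torus.IsDivFree u₀) (hmean : Torus.HasZeroMean u₀)
    (hclose : 2 * Real.pi * Real.sqrt (24 *
        ∑' k : Fin 3 → ℤ, (if k = 0 then (0 : ℝ) else freqNormSq k ^ (-(s - 1)))) *
      Real.sqrt (∑' k : Fin 3 → ℤ, freqNormSq k ^ s *
        ‖mFourierCoeff (EuclideanSpace.complexify ∘
          (fun y => u₀ y - IntermittentBeltrami.beltramiField n a y)) k‖ ^ 2) *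
        Real.exp ((2 * Real.pi * Real.sqrt (24 *
            ∑' k : Fin 3 → ℤ, (if k = 0 then (0 : ℝ) else freqNormSq k ^ (-(s - 1)))) *
            ((5 * |(n : ℝ)|) ^ s * Real.sqrt (∑ y : LIndex, ‖a y‖ ^ 2)) +
          2 * Real.pi * Real.sqrt (((2 : ℝ) ^ (2 * s + 2) * (s + 1) ^ (s + 1) / (s + 2) ^ (s + 2)) *
            ∑' k : Fin 3 → ℤ, (if k = 0 then (0 : ℝ) else freqNormSq k ^ (-s))) *
            ((5 * |(n : ℝ)|) ^ (s + 1) * Real.sqrt (∑ y : LIndex, ‖a y‖ ^ 2))) /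
              (ν * (2 * Real.pi * (5 * (n : ℝ))) ^ 2)) <
        4 * Real.pi ^ 2 * ν) :
    ∃ (u : ℝ → UnitAddTorus (Fin 3) → EuclideanSpace ℝ (Fin 3))
      (p : ℝ → UnitAddTorus (Fin 3) → ℝ),
      Torus.IsClassicalNSSolutionOn (Ici 0) ν 0 u p ∧ u 0 = u₀ ∧
      (∀ t ∈ Ici (0 : ℝ), Torus.HasZeroMean (u t)) ∧
      ∀ t ∈ Ici (0 : ℝ), Real.sqrt (∑' k : Fin 3 → ℤ, freqNormSq k ^ s *
        ‖mFourierCoeff (EuclideanSpace.complexify ∘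
          (fun y => u t y - Real.exp (-(ν * (2 * Real.pi * (5 * (n : ℝ))) ^ 2) * t) •
            IntermittentBeltrami.beltramiField n a y)) k‖ ^ 2) ≤
        Real.sqrt (∑' k : Fin 3 → ℤ, freqNormSq k ^ s *
          ‖mFourierCoeff (EuclideanSpace.complexify ∘
            (fun y => u₀ y - IntermittentBeltrami.beltramiField n a y)) k‖ ^ 2) *
          Real.exp ((2 * Real.pi * Real.sqrt (24 *
              ∑' k : Fin 3 → ℤ, (if k = 0 then (0 : ℝ) else freqNormSq k ^ (-(s - 1)))) *
              ((5 * |(n : ℝ)|) ^ s * Real.sqrt (∑ y : LIndex, ‖a y‖ ^ 2)) +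
            2 * Real.pi * Real.sqrt (((2 : ℝ) ^ (2 * s + 2) * (s + 1) ^ (s + 1) / (s + 2) ^ (s + 2)) *
              ∑' k : Fin 3 → ℤ, (if k = 0 then (0 : ℝ) else freqNormSq k ^ (-s))) *
              ((5 * |(n : ℝ)|) ^ (s + 1) * Real.sqrt (∑ y : LIndex, ‖a y‖ ^ 2))) /
                (ν * (2 * Real.pi * (5 * (n : ℝ))) ^ 2)) *
          Real.exp (-(4 * Real.pi ^ 2 * ν) * t) /
          (1 - 2 * Real.pi * Real.sqrt (24 *
              ∑' k : Fin 3 → ℤ, (if k = 0 then (0 : ℝ) else freqNormSq k ^ (-(s - 1)))) *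
            Real.sqrt (∑' k : Fin 3 → ℤ, freqNormSq k ^ s *
              ‖mFourierCoeff (EuclideanSpace.complexify ∘
                (fun y => u₀ y - IntermittentBeltrami.beltramiField n a y)) k‖ ^ 2) *
            Real.exp ((2 * Real.pi * Real.sqrt (24 *
                ∑' k : Fin 3 → ℤ, (if k = 0 then (0 : ℝ) else freqNormSq k ^ (-(s - 1)))) *
                ((5 * |(n : ℝ)|) ^ s * Real.sqrt (∑ y : LIndex, ‖a y‖ ^ 2)) +
              2 * Real.pi * Real.sqrt (((2 : ℝ) ^ (2 * s + 2) * (s + 1) ^ (s + 1) / (s + 2) ^ (s + 2)) *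
                ∑' k : Fin 3 → ℤ, (if k = 0 then (0 : ℝ) else freqNormSq k ^ (-s))) *
                ((5 * |(n : ℝ)|) ^ (s + 1) * Real.sqrt (∑ y : LIndex, ‖a y‖ ^ 2))) /
                  (ν * (2 * Real.pi * (5 * (n : ℝ))) ^ 2)) /
            (4 * Real.pi ^ 2 * ν)) := by
  have hlam : (2 * Real.pi * (5 * (n : ℝ)) : ℝ) ≠ 0 :=
    mul_ne_zero (ne_of_gt Real.two_pi_pos) (mul_ne_zero (by norm_num) (Int.cast_ne_zero.mpr hn))
  have h := Torus.classicalNS_global_stability_of_curl_eq_smul_three hν hs3 hlam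
    (IntermittentBeltrami.isSmooth_beltramiField n a) (IntermittentBeltrami.isDivFree_beltramiField n a)
    (IntermittentBeltrami.hasZeroMean_beltramiField ha hn) (IntermittentBeltrami.curl_beltramiField n a)
    hu₀ hdiv hmean
  simp only [zd_abs_lam_div, IntermittentBeltrami.integral_norm_sq_beltramiField ha hn] at h
  exact h hclose

end CurlForm

end Literature.Analysis.FluidPDE
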